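import Mathlib.Analysis.SpecialFunctions.BinaryEntropy
import Mathlib.Analysis.SpecialFunctions.Pow.Real
import Mathlib.Algebra.Order.Floor.Defs
import Mathlib.Data.Nat.Choose.Sum
import HarnessLib

/-!
# The entropy bound for partial sums of binomial coefficients

`Literature/Combinatorics`: the volume of a Hamming ball of radius `λ n`, `λ ≤ 1/2`, is at
most `2^{n H(λ)}` — van Lint, *Introduction to Coding Theory* (GTM 86, 2nd ed. 1992),
Theorem 1.4.5 (i), pp. 66–67:

> Let `0 ≤ λ ≤ 1/2`. Then `Σ_{0 ≤ i ≤ λ n} (n choose i) ≤ 2^{n H(λ)}`,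

`H(x) = -x log₂ x - (1 - x) log₂ (1 - x)` the binary entropy function. PROVED here
(`vanLint_sum_choose_le_exp_binEntropy`, natural-log form with Mathlib's `Real.binEntropy`
in nats: `Σ_{i ≤ λn} (n choose i) ≤ exp (n · binEntropy λ)`; `vanLint_sum_choose_le_two_rpow`,
the printed base-`2` form `≤ 2 ^ (binEntropy λ / log 2 · n)`), by the printed one-line
argument: `1 = (λ + (1 - λ))^n ≥ Σ_{i ≤ λn} (n choose i) λ^i (1 - λ)^{n - i}
≥ Σ_{i ≤ λn} (n choose i) (1 - λ)^n (λ/(1 - λ))^{λ n} = 2^{-n H(λ)} Σ_{i ≤ λn} (n choose i)`.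

This is the estimate behind "exhaustive search of the assignments with at most `δ n` ones
takes time `2^{h(δ) n}`" (Impagliazzo–Paturi 2001, p. 370; the named fact
`Literature.Computability.FineGrained.lightKSAT_exhaustiveSearch`). Not in Mathlib (which has `Real.binEntropy`
and `Nat.sum_range_choose`, but no entropy estimate of partial binomial sums).

## References

* J. H. van Lint, *Introduction to Coding Theory*, 2nd ed., GTM 86, Springer 1992,
  Theorem 1.4.5 (i), pp. 66–67. doi:10.1007/978-3-662-00174-5
* R. Impagliazzo, R. Paturi, *On the complexity of k-SAT*, JCSS 62 (2001), p. 370 (the use).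
-/

namespace Literature.Combinatorics

open Real Finset

/-- For `0 < λ ≤ 1/2`, `0 ≤ i ≤ λ n`: the Bernoulli weight `λ^i (1-λ)^{n-i}` is at least
`exp (-n · binEntropy λ) = λ^{λ n} (1 - λ)^{(1 - λ) n}` (the ratio `λ/(1-λ) ≤ 1` is raised to
a power `i ≤ λ n`). [cite: Vanlint1992, Theorem 1.4.5 (i), proof (p. 67)] -/
theorem exp_neg_mul_binEntropy_le_weight {n i : ℕ} {l : ℝ} (h0 : 0 < l) (h1 : l ≤ 1 / 2)
    (hin : i ≤ n) (hi : (i : ℝ) ≤ l * n) :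
    Real.exp (-(n * binEntropy l)) ≤ l ^ i * (1 - l) ^ (n - i) := by
  have h1' : l < 1 := by linarith
  have hq : 0 < 1 - l := by linarith
  set r := l / (1 - l) with hr
  have hr0 : 0 < r := div_pos h0 hq
  have hr1 : r ≤ 1 := by rw [hr, div_le_one hq]; linarith
  -- rewrite the weight as `(1 - l)^n * r^i`
  have hw : l ^ i * (1 - l) ^ (n - i) = (1 - l) ^ n * r ^ (i : ℝ) := by
    rw [Real.rpow_natCast, hr, div_pow]
    have : (1 - l) ^ n = (1 - l) ^ (n - i) * (1 - l) ^ i := by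
      rw [← pow_add, Nat.sub_add_cancel hin]
    rw [this]
    field_simp
  rw [hw]
  -- `r^i ≥ r^(l n)` and the closed form of `(1 - l)^n r^(l n)`
  have hmono : r ^ (l * n) ≤ r ^ (i : ℝ) := Real.rpow_le_rpow_of_exponent_ge hr0 hr1 hi
  have hclosed : Real.exp (-(n * binEntropy l)) = (1 - l) ^ n * r ^ (l * n) := by
    rw [hr, Real.div_rpow h0.le hq.le, ← Real.rpow_natCast (1 - l) n]
    have e1 : (1 - l) ^ (n : ℝ) * (l ^ (l * n) / (1 - l) ^ (l * n)) =
        l ^ (l * n) * (1 - l) ^ ((1 - l) * n) := by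
      rw [mul_div_assoc', mul_comm ((1 - l) ^ (n : ℝ)), mul_div_assoc]
      congr 1
      rw [← Real.rpow_sub hq]
      congr 1; ring
    rw [e1, Real.rpow_def_of_pos h0, Real.rpow_def_of_pos hq, ← Real.exp_add]
    congr 1
    simp only [binEntropy, Real.log_inv]
    ring
  rw [hclosed]
  exact mul_le_mul_of_nonneg_left hmono (pow_nonneg hq.le n)

/-- **van Lint's Theorem 1.4.5 (i)**, natural-log form: for `0 ≤ λ ≤ 1/2`,
`Σ_{0 ≤ i ≤ λ n} (n choose i) ≤ exp (n · binEntropy λ)` (`binEntropy` in nats).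
[cite: Vanlint1992, Theorem 1.4.5 (i) (pp. 66–67)] -/
theorem vanLint_sum_choose_le_exp_binEntropy (n : ℕ) {l : ℝ} (h0 : 0 ≤ l) (h1 : l ≤ 1 / 2) :
    (∑ i ∈ range (⌊l * n⌋₊ + 1), (n.choose i : ℝ)) ≤ Real.exp (n * binEntropy l) := by
  rcases h0.eq_or_lt with rfl | h0
  · simp
  set m := ⌊l * n⌋₊ with hm
  have hmn : m ≤ n := by
    refine Nat.floor_le_of_le ?_
    calc l * (n : ℝ) ≤ 1 * (n : ℝ) := by gcongr; linarith
      _ = n := one_mul _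
  -- the binomial theorem, restricted to `i ≤ m`
  have hbin : ∑ i ∈ range (n + 1), l ^ i * (1 - l) ^ (n - i) * (n.choose i : ℝ) = 1 := by
    have := (add_pow l (1 - l) n).symm
    rwa [add_sub_cancel, one_pow] at this
  have hsub : ∑ i ∈ range (m + 1), l ^ i * (1 - l) ^ (n - i) * (n.choose i : ℝ) ≤ 1 := by
    calc ∑ i ∈ range (m + 1), l ^ i * (1 - l) ^ (n - i) * (n.choose i : ℝ)
        ≤ ∑ i ∈ range (n + 1), l ^ i * (1 - l) ^ (n - i) * (n.choose i : ℝ) := by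
          apply Finset.sum_le_sum_of_subset_of_nonneg (Finset.range_subset_range.2 (by omega))
          intro i _ _
          have : 0 ≤ 1 - l := by linarith
          positivity
      _ = 1 := hbin
  -- each weight is at least `exp (-n H)`
  have hlow : Real.exp (-(n * binEntropy l)) * ∑ i ∈ range (m + 1), (n.choose i : ℝ) ≤
      ∑ i ∈ range (m + 1), l ^ i * (1 - l) ^ (n - i) * (n.choose i : ℝ) := by
    rw [mul_sum]
    refine sum_le_sum fun i hi => ?_
    rw [mem_range] at hi
    have hin : i ≤ n := by omega
    have hi' : (i : ℝ) ≤ l * n := by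
      have : i ≤ m := by omega
      exact (Nat.cast_le.2 this).trans (Nat.floor_le (by positivity))
    have := exp_neg_mul_binEntropy_le_weight h0 h1 hin hi'
    exact mul_le_mul_of_nonneg_right this (Nat.cast_nonneg _)
  have hpos : 0 < Real.exp (-(n * binEntropy l)) := Real.exp_pos _
  have key : Real.exp (-(n * binEntropy l)) * ∑ i ∈ range (m + 1), (n.choose i : ℝ) ≤ 1 :=
    hlow.trans hsub
  calc ∑ i ∈ range (m + 1), (n.choose i : ℝ)
      = Real.exp (n * binEntropy l) * (Real.exp (-(n * binEntropy l)) *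
          ∑ i ∈ range (m + 1), (n.choose i : ℝ)) := by
        rw [← mul_assoc, ← Real.exp_add, add_neg_cancel, Real.exp_zero, one_mul]
    _ ≤ Real.exp (n * binEntropy l) * 1 := mul_le_mul_of_nonneg_left key (Real.exp_pos _).le
    _ = Real.exp (n * binEntropy l) := mul_one _

/-- **van Lint's Theorem 1.4.5 (i)**, printed base-`2` form: for `0 ≤ λ ≤ 1/2`,
`Σ_{0 ≤ i ≤ λ n} (n choose i) ≤ 2 ^ (H(λ) n)` with `H(λ) = binEntropy λ / log 2` the binary
entropy in bits. [cite: Vanlint1992, Theorem 1.4.5 (i) (pp. 66–67)] -/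
theorem vanLint_sum_choose_le_two_rpow (n : ℕ) {l : ℝ} (h0 : 0 ≤ l) (h1 : l ≤ 1 / 2) :
    (∑ i ∈ range (⌊l * n⌋₊ + 1), (n.choose i : ℝ)) ≤ (2 : ℝ) ^ (binEntropy l / Real.log 2 * n) := by
  have h := vanLint_sum_choose_le_exp_binEntropy n h0 h1
  have e : (2 : ℝ) ^ (binEntropy l / Real.log 2 * n) = Real.exp (n * binEntropy l) := by
    rw [Real.rpow_def_of_pos two_pos]
    congr 1
    have : Real.log 2 ≠ 0 := by positivity
    field_simp
  rwa [e]

/-! ### Integer Chernoff trick (no real analysis): `t^n Σ_{k≤m} C(n,k) ≤ t^m (t+1)^n` -/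

/-- **Integer Chernoff trick for partial binomial sums.**  For every `t ≥ 1` and all `n, m`:
`t^n · Σ_{k ≤ m} C(n,k) ≤ t^m · (t+1)^n`, i.e. `Σ_{k≤m} C(n,k) ≤ (1 + 1/t)^n · t^m` — the
generating-function estimate `(1+t)^n ≥ C(n,k)·t^k` summed over `k ≤ m`.  With `t = 3` and
`4m ≤ n` this gives `Σ_{k ≤ m} C(n,k) ≤ 4^n/3^{n−m} ≤ 2^n·(16/27)^{n/4}` (see
`pow_three_mul_sum_range_choose_le`), an exponentially small fraction of the cube, in `ℕ`.
[cite: Jukna2011, §1.1, proof of Proposition 1.3 (PDF p. 27: `(1+t)^n ≥ binom(n,k)·t^k`); the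
partial-sum integer form is supplied here (consumer: qa-qnc0 ROUND-35, pair slicing S4)] -/
theorem pow_mul_sum_range_choose_le (n m t : ℕ) (ht : 1 ≤ t) :
    t ^ n * ∑ k ∈ Finset.range (m + 1), n.choose k ≤ t ^ m * (t + 1) ^ n := by
  -- termwise: C(n,k)·t^n ≤ C(n,k)·t^{n−k}·t^m for k ≤ m
  have hterm : ∀ k ∈ Finset.range (m + 1),
      t ^ n * n.choose k ≤ t ^ m * (n.choose k * t ^ (n - k)) := by
    intro k hk
    have hkm : k ≤ m := Nat.lt_succ_iff.1 (Finset.mem_range.1 hk)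
    have hpow : t ^ n ≤ t ^ m * t ^ (n - k) := by
      rw [← pow_add]
      exact Nat.pow_le_pow_right ht (by omega)
    calc t ^ n * n.choose k ≤ (t ^ m * t ^ (n - k)) * n.choose k := Nat.mul_le_mul_right _ hpow
      _ = t ^ m * (n.choose k * t ^ (n - k)) := by ring
  -- the partial sum of C(n,k) t^{n−k} is at most the full binomial expansion (1+t)^n
  have hpartial : ∑ k ∈ Finset.range (m + 1), n.choose k * t ^ (n - k)
      ≤ ∑ k ∈ Finset.range (n + 1), n.choose k * t ^ (n - k) := by
    rw [← Finset.sum_filter_of_ne (s := Finset.range (m + 1)) (p := fun k => k < n + 1)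
      (fun k _ hne => by
        by_contra hk
        exact hne (by rw [Nat.choose_eq_zero_of_lt (by omega), zero_mul]))]
    exact Finset.sum_le_sum_of_subset_of_nonneg
      (fun k hk => Finset.mem_range.2 (Finset.mem_filter.1 hk).2) (fun _ _ _ => Nat.zero_le _)
  have hfull : ∑ k ∈ Finset.range (n + 1), n.choose k * t ^ (n - k) = (t + 1) ^ n := by
    rw [show t + 1 = 1 + t from Nat.add_comm t 1, add_pow]
    exact Finset.sum_congr rfl fun k _ => by rw [one_pow, one_mul, mul_comm, Nat.cast_id]
  calc t ^ n * ∑ k ∈ Finset.range (m + 1), n.choose k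
      = ∑ k ∈ Finset.range (m + 1), t ^ n * n.choose k := Finset.mul_sum _ _ _
    _ ≤ ∑ k ∈ Finset.range (m + 1), t ^ m * (n.choose k * t ^ (n - k)) := Finset.sum_le_sum hterm
    _ = t ^ m * ∑ k ∈ Finset.range (m + 1), n.choose k * t ^ (n - k) := (Finset.mul_sum _ _ _).symm
    _ ≤ t ^ m * (t + 1) ^ n := by rw [← hfull]; exact Nat.mul_le_mul_left _ hpartial

/-- The `t = 3` instance in quotient-free form: for `m ≤ n`, `3^{n−m} · Σ_{k ≤ m} C(n,k) ≤ 4^n`.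
(For `4m ≤ n`: `3^{n−m} ≥ 27^{n/4} > 16^{n/4}·(27/16)^{⌊n/4⌋}`, so the partial sum is at most
`2^n·(16/27)^{⌊n/4⌋}` up to rounding.)
[cite: Jukna2011, §1.1, proof of Proposition 1.3 (PDF p. 27); supplied here] -/
theorem pow_three_mul_sum_range_choose_le {n m : ℕ} (hmn : m ≤ n) :
    3 ^ (n - m) * ∑ k ∈ Finset.range (m + 1), n.choose k ≤ 4 ^ n := by
  have h := pow_mul_sum_range_choose_le n m 3 (by norm_num)
  have h3 : (3 : ℕ) ^ n = 3 ^ m * 3 ^ (n - m) := by rw [← pow_add, Nat.add_sub_cancel' hmn]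
  rw [h3, mul_assoc] at h
  exact Nat.le_of_mul_le_mul_left h (by positivity)

end Literature.Combinatorics
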